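import Literature.NumberTheory.EllipticCurves.PeriodRationalityProofs
import Literature.NumberTheory.EllipticCurves.HaberlandFormulaProofs
import HarnessLib

/-!
# Rationality of the Haberland form of a newform (Paşol–Popa Lemma 4.1 and the proof of
# Prop. 5.11(b)): `∑_x ⟨σ_T R_f(T⁻¹x) - σ_T' R_f(Tx), \overline{R_f(x)}⟩ ∈ K_fΩ⁺² + K_fΩ⁻² + K_fΩ⁺Ω⁻i`

Theorems only (no definitions, no named facts). Algebraic brick of the proof of the (corrected)
Prop. 5.11(b) of V. Paşol, A. A. Popa, *Modular forms and period polynomials*, Proc. LMS 107 (2013)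
[PasolPopa2013] ("Part (b) follows from (a) and Theorem 3.3"): by Haberland's formula
(`HaberlandAlgebra.six_mul_petersson_eq_sum_coset`: `6(2i)ⁿ⁺¹(f,f)` is the Haberland form
`B(R_f, R̄_f) = ∑_x ⟨σ_T R_f(T⁻¹x) - σ_T' R_f(Tx), \overline{R_f(x)}⟩` of the M-symbol vector
`R_f(x)ⱼ = msymbK n x j f` with its conjugate), the Petersson norm of a newform `f` of even weight
`n + 2 ≥ 4` is controlled by the period values of `f`. The cuspidal period values lie in
`K_fΩ⁺ + K_fΩ⁻i` (`IsNewform0.exists_periods_criticalValues'`, Shimura's theorem); the remaining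
(Eisenstein) coordinates of `R_f` do not — but they do not matter:

* `HaberlandRationality.haberlandForm_coboundary_left`, `span_cobVec_pairing_left` — **PP Lemma 4.1**
  in moment coordinates: the coboundary space `C = span{c^κ}`,
  `c^κ(x) = [x⁻¹∞ = κ]δₙ - σ_S([ (S⁻¹x)⁻¹∞ = κ]δₙ)` (the duals of the boundary map `bdryKMap`:
  `sum_mul_cobVec`), lies in the radical of `B` restricted to vectors satisfying the period
  relations (`B(c, w) = 0`; proof by the pointwise `key_identities` derived from `w|(1+S) = 0`,
  `w|(1+U+U²) = 0`, and the invariance/adjunctions of the pairing `invForm`,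
  `sum_invForm_twistP/Pinv/S_smul`; `haberlandForm_antisymm`: `B(u,v) = -B(v,u)`);
  `cobVec_relations`, `span_cobVec_relations` — `C ⊆ W` (PP §2, Lemma 4.2);
* `HaberlandRationality.exists_complex_proj` — a rational projection `Π` along `C`
  (`Submodule.exists_isCompl`, `Submodule.projection`), complexified: `Π(c^κ) = 0`, `u - Πu ∈ C_ℂ`,
  and the rows of its matrix have zero boundary, so that the coordinates of `Π R_f` are values at
  `f` of RATIONAL CUSPIDAL classes (`span_cuspidalLatticeK_eq_map_ker`), hence in `K_fΩ⁺ + K_fΩ⁻i`;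
* **`HaberlandRationality.haberlandForm_self_inQuad`** — for a newform `f ∈ S_{n+2}(Γ₀(N))`,
  `n` even `≠ 0`, and periods `Ω⁺, Ω⁻` with all cuspidal period values in `K_fΩ⁺ + K_fΩ⁻i`:
  `B(R_f, R̄_f) = B(ΠR_f, \overline{ΠR_f}) ∈ K_fΩ⁺² + K_fΩ⁻² + K_fΩ⁺Ω⁻i`.

The predicates "`z ∈ KΩ⁺ + KΩ⁻i`", "`z ∈ KΩ⁺² + KΩ⁻² + KΩ⁺Ω⁻i`" are spelled out as explicit
existential statements (no definition is introduced).

## References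

* [PasolPopa2013] V. Paşol, A. A. Popa, Proc. LMS 107 (2013) 713–743, arXiv:1202.5802: §2
  (`C_w^Γ ⊂ W_w^Γ`), Lemma 4.1, Lemma 4.2, Prop. 5.11(b) (proof).
-/

noncomputable section

open MeasureTheory Set Filter Topology Complex
open scoped ComplexConjugate UpperHalfPlane MatrixGroups ModularForm

namespace Literature.NumberTheory.EllipticCurves.ModularForms

namespace HaberlandRationality


open ModularGroup CongruenceSubgroup HaberlandAlgebra

variable {N : ℕ} {n : ℕ}

/-! ### Twist identities on the cusp vectors -/

/-- `σ_T δₙ = δₙ` (the constant polynomial is translation invariant). [folklore] -/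
theorem twistP_mulVec_single_last : (twistP n).mulVec (Pi.single (Fin.last n) (1 : ℂ)) = Pi.single (Fin.last n) 1 := by
  funext j
  rw [twistP_mulVec, Finset.sum_eq_single (Fin.last n) (fun i _ hi ↦ by simp [hi]) (by simp)]
  by_cases hj : j = Fin.last n
  · subst hj; simp
  · have hjn : (j : ℕ) < n := by
      have := fin_le j
      rcases lt_or_eq_of_le this with h | h
      · exact h
      · exact absurd (Fin.ext (by simpa using h)) hj
    rw [Pi.single_eq_of_ne hj, Pi.single_eq_same, if_neg (by simp; omega)]
    simp

/-- `σ_T' δₙ = δₙ`. [folklore] -/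
theorem twistPinv_mulVec_single_last :
    (twistPinv n).mulVec (Pi.single (Fin.last n) (1 : ℂ)) = Pi.single (Fin.last n) 1 := by
  funext j
  rw [twistPinv_mulVec, Finset.sum_eq_single (Fin.last n) (fun i _ hi ↦ by simp [hi]) (by simp)]
  by_cases hj : j = Fin.last n
  · subst hj; simp
  · have hjn : (j : ℕ) < n := by
      have := fin_le j
      rcases lt_or_eq_of_le this with h | h
      · exact h
      · exact absurd (Fin.ext (by simpa using h)) hj
    rw [Pi.single_eq_of_ne hj, Pi.single_eq_same, if_neg (by simp; omega)]
    simp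

/-- `σ_S δₙ = δ₀`. [folklore] -/
theorem twistS_mulVec_single_last :
    (twistS n).mulVec (Pi.single (Fin.last n) (1 : ℂ)) = Pi.single 0 1 := by
  funext j
  rw [twistS_mulVec]
  have h2 : Fin.rev (0 : Fin (n + 1)) = Fin.last n := by apply Fin.ext; rw [val_rev_eq]; simp
  by_cases hj : j = 0
  · subst hj; rw [h2]; simp
  · have hne : Fin.rev j ≠ Fin.last n := fun h ↦ hj (by
      have := congrArg Fin.rev h; rw [Fin.rev_rev] at this; rw [this, ← h2, Fin.rev_rev])
    rw [Pi.single_eq_of_ne hne, Pi.single_eq_of_ne hj, mul_zero]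

/-! ### Adjunctions and re-indexing over the cosets -/

variable [NeZero N]

/-- `σ_T' σ_T = 1`. [folklore] -/
theorem twistPinv_mul_twistP (hn : Even n) : twistPinv n * twistP n = (1 : Matrix _ _ ℂ) :=
  mul_eq_one_comm.mp (twistP_mul_twistPinv hn)

/-- Re-indexing a sum over cosets by `x ↦ s • x`. [folklore] -/
theorem sum_smul_coset {M : Type*} [AddCommMonoid M] (F : Gamma0Coset N → M) (s : SL(2, ℤ)) :
    ∑ x, F (s • x) = ∑ x, F x :=
  Fintype.sum_bijective _ (MulAction.bijective s) _ _ fun _ ↦ rfl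

/-- Adjunction for `T`: `∑_x ⟨σ_T u(T⁻¹x), v(x)⟩ = ∑_y ⟨u(y), σ_T' v(Ty)⟩`. [folklore] -/
theorem sum_invForm_twistP_smul (hn : Even n) (u v : Gamma0Coset N → Fin (n + 1) → ℂ) :
    ∑ x, invForm n ((twistP n).mulVec (u (T⁻¹ • x))) (v x) =
      ∑ y, invForm n (u y) ((twistPinv n).mulVec (v (T • y))) := by
  rw [← sum_smul_coset (fun x ↦ invForm n ((twistP n).mulVec (u (T⁻¹ • x))) (v x)) T]
  refine Finset.sum_congr rfl fun y _ ↦ ?_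
  rw [inv_smul_smul, ← invForm_twistPinv hn, Matrix.mulVec_mulVec, twistPinv_mul_twistP hn,
    Matrix.one_mulVec]

/-- Adjunction for `T⁻¹`: `∑_x ⟨σ_T' u(Tx), v(x)⟩ = ∑_y ⟨u(y), σ_T v(T⁻¹y)⟩`. [folklore] -/
theorem sum_invForm_twistPinv_smul (hn : Even n) (u v : Gamma0Coset N → Fin (n + 1) → ℂ) :
    ∑ x, invForm n ((twistPinv n).mulVec (u (T • x))) (v x) =
      ∑ y, invForm n (u y) ((twistP n).mulVec (v (T⁻¹ • y))) := by
  rw [← sum_smul_coset (fun x ↦ invForm n ((twistPinv n).mulVec (u (T • x))) (v x)) T⁻¹]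
  refine Finset.sum_congr rfl fun y _ ↦ ?_
  rw [smul_inv_smul, ← invForm_twistP hn, Matrix.mulVec_mulVec, twistP_mul_twistPinv hn,
    Matrix.one_mulVec]

/-- Adjunction for `S`: `∑_x ⟨σ_S u(S⁻¹x), v(x)⟩ = ∑_y ⟨u(y), σ_S v(S y)⟩`. [folklore] -/
theorem sum_invForm_twistS_smul (hn : Even n) (u v : Gamma0Coset N → Fin (n + 1) → ℂ) :
    ∑ x, invForm n ((twistS n).mulVec (u (S⁻¹ • x))) (v x) =
      ∑ y, invForm n (u y) ((twistS n).mulVec (v (S • y))) := by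
  rw [← sum_smul_coset (fun x ↦ invForm n ((twistS n).mulVec (u (S⁻¹ • x))) (v x)) S]
  refine Finset.sum_congr rfl fun y _ ↦ ?_
  rw [inv_smul_smul, ← invForm_twistS hn, Matrix.mulVec_mulVec, twistS_mul_twistS hn, Matrix.one_mulVec]

/-- **Antisymmetry of the Haberland form** (even `n`): `B(u, v) = -B(v, u)`,
`B(u, v) = ∑_x ⟨σ_T u(T⁻¹x) - σ_T' u(Tx), v(x)⟩` (Paşol–Popa: `{P,Q} = (-1)^{w+1}{Q,P}`). [cite: PasolPopa2013, §3 (the pairing {·,·})] -/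
theorem haberlandForm_antisymm (hn : Even n) (u v : Gamma0Coset N → Fin (n + 1) → ℂ) :
    ∑ x, invForm n ((twistP n).mulVec (u (T⁻¹ • x)) - (twistPinv n).mulVec (u (T • x))) (v x) =
      -∑ x, invForm n ((twistP n).mulVec (v (T⁻¹ • x)) - (twistPinv n).mulVec (v (T • x))) (u x) := by
  simp only [map_sub, LinearMap.sub_apply, Finset.sum_sub_distrib]
  rw [sum_invForm_twistP_smul hn u v, sum_invForm_twistPinv_smul hn u v]
  have e1 : ∑ x, invForm n ((twistP n).mulVec (v (T⁻¹ • x))) (u x) =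
      ∑ x, invForm n (u x) ((twistP n).mulVec (v (T⁻¹ • x))) :=
    Finset.sum_congr rfl fun x _ ↦ invForm_comm hn _ _
  have e2 : ∑ x, invForm n ((twistPinv n).mulVec (v (T • x))) (u x) =
      ∑ x, invForm n (u x) ((twistPinv n).mulVec (v (T • x))) :=
    Finset.sum_congr rfl fun x _ ↦ invForm_comm hn _ _
  rw [e1, e2]
  ring

/-! ### The coboundary vectors `c^κ` and Lemma 4.1 of Paşol–Popa -/

omit [NeZero N] in
/-- **The relations of a period-polynomial vector imply the pointwise identities**
`σ_S σ_T' w(T S⁻¹ y) = -w(y) + σ_T w(T⁻¹y)` and `σ_S σ_T w(T⁻¹S⁻¹y) = -w(y) + σ_T' w(Ty)`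
(from `w|(1+S) = 0`, `w|(1+U+U²) = 0`, `U = TS`). [folklore] -/
theorem key_identities (hn : Even n) (w : Gamma0Coset N → Fin (n + 1) → ℂ)
    (h2 : ∀ y, w y + (twistS n).mulVec (w (S⁻¹ • y)) = 0)
    (h3 : ∀ y, w y + (twistU n).mulVec (w ((T * S)⁻¹ • y)) +
      (twistU n).mulVec ((twistU n).mulVec (w (((T * S)⁻¹) ^ 2 • y))) = 0) (y : Gamma0Coset N) :
    (twistS n).mulVec ((twistPinv n).mulVec (w (T • S • y))) = -w y + (twistP n).mulVec (w (T⁻¹ • y)) ∧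
    (twistS n).mulVec ((twistP n).mulVec (w (T⁻¹ • S • y))) = -w y + (twistPinv n).mulVec (w (T • y)) := by
  have hU3 : ∀ v : Fin (n + 1) → ℂ, (twistU n).mulVec ((twistU n).mulVec ((twistU n).mulVec v)) = v := by
    intro v
    rw [Matrix.mulVec_mulVec, Matrix.mulVec_mulVec, ← pow_three', twistU_pow_three hn, Matrix.one_mulVec]
  have hSU2 : ∀ v : Fin (n + 1) → ℂ, (twistS n).mulVec ((twistU n).mulVec ((twistU n).mulVec v)) =
      (twistPinv n).mulVec v := by
    intro v
    rw [Matrix.mulVec_mulVec, Matrix.mulVec_mulVec, mul_assoc, twistU_mul_twistU hn, ← mul_assoc,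
      twistS_mul_twistS hn, one_mul]
  have hSP : ∀ v : Fin (n + 1) → ℂ, (twistS n).mulVec ((twistPinv n).mulVec v) =
      (twistU n).mulVec ((twistU n).mulVec v) := by
    intro v
    rw [Matrix.mulVec_mulVec, Matrix.mulVec_mulVec, twistU_mul_twistU hn]
  have hPS : ∀ v : Fin (n + 1) → ℂ, (twistP n).mulVec ((twistS n).mulVec v) = (twistU n).mulVec v := by
    intro v
    rw [Matrix.mulVec_mulVec, twistU]
  -- coset identities
  have hSinv : ∀ z : Gamma0Coset N, S⁻¹ • z = S • z := fun z ↦ by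
    rw [ModularGroup.S_inv, show -S = (-1 : SL(2, ℤ)) * S by simp, mul_smul, neg_one_smul_coset]
  have hTS : T • S • y = (T * S) • y := by rw [← mul_smul]
  have hU2S : ((T * S)⁻¹) ^ 2 • S • y = T • y := by
    rw [← mul_smul, show ((T * S)⁻¹) ^ 2 * S = T by decide]
  constructor
  · -- KEY 1
    have E3 := h3 ((T * S) • y)
    rw [inv_smul_smul, pow_two, mul_smul ((T * S)⁻¹) ((T * S)⁻¹), inv_smul_smul] at E3
    have E2 := h2 (T⁻¹ • y)
    rw [← mul_smul, ← mul_inv_rev] at E2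
    have E2' : (twistU n).mulVec (w ((T * S)⁻¹ • y)) = -(twistP n).mulVec (w (T⁻¹ • y)) := by
      have := congrArg ((twistP n).mulVec) E2
      rw [Matrix.mulVec_add, hPS, Matrix.mulVec_zero] at this
      exact eq_neg_of_add_eq_zero_right this
    have E3' := congrArg (fun v ↦ (twistU n).mulVec ((twistU n).mulVec v)) E3
    simp only [Matrix.mulVec_add, Matrix.mulVec_zero, hU3] at E3'
    rw [hTS, hSP]
    have h := eq_neg_of_add_eq_zero_left (by rw [add_assoc] at E3'; exact E3')
    rw [h, E2', neg_add, neg_neg]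
  · -- KEY 2
    have E2a := h2 (T⁻¹ • S • y)
    rw [← mul_smul S⁻¹ T⁻¹, ← mul_inv_rev] at E2a
    have hw : w (T⁻¹ • S • y) = -(twistS n).mulVec (w ((T * S)⁻¹ • S • y)) :=
      eq_neg_of_add_eq_zero_left E2a
    have E3 := h3 (S • y)
    rw [hU2S] at E3
    have hmid : (twistU n).mulVec (w ((T * S)⁻¹ • S • y)) =
        -w (S • y) - (twistU n).mulVec ((twistU n).mulVec (w (T • y))) := by
      have h' : (twistU n).mulVec (w ((T * S)⁻¹ • S • y)) +
          (w (S • y) + (twistU n).mulVec ((twistU n).mulVec (w (T • y)))) = 0 := by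
        rw [← E3]; abel
      rw [eq_neg_of_add_eq_zero_left h', neg_add, sub_eq_add_neg]
    have hSw : (twistS n).mulVec (w (S • y)) = -w y := by
      rw [← hSinv]; exact eq_neg_of_add_eq_zero_right (h2 y)
    rw [hw, Matrix.mulVec_neg, Matrix.mulVec_neg, hPS, hmid, Matrix.mulVec_sub, Matrix.mulVec_neg, hSw,
      hSU2]
    abel

/-- **Paşol–Popa Lemma 4.1 (the coboundary polynomials are in the radical of the pairing)**, in
moment coordinates and for even `n`: if `P` is a `T`-invariant coset function with values fixed by
`σ_T, σ_T'` (e.g. constant polynomials supported on the cosets of one cusp) and `w` satisfies the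
period relations `w|(1+S) = 0`, `w|(1+U+U²) = 0`, then `B(P|(1-S), w) = 0` for the Haberland form
`B(u, v) = ∑_x ⟨σ_T u(T⁻¹x) - σ_T' u(Tx), v(x)⟩`. [cite: PasolPopa2013, Lemma 4.1] -/
theorem haberlandForm_coboundary_left (hn : Even n) (P w : Gamma0Coset N → Fin (n + 1) → ℂ)
    (hPT : ∀ x, P (T • x) = P x) (hPP : ∀ x, (twistP n).mulVec (P x) = P x)
    (hPPinv : ∀ x, (twistPinv n).mulVec (P x) = P x)
    (h2 : ∀ y, w y + (twistS n).mulVec (w (S⁻¹ • y)) = 0)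
    (h3 : ∀ y, w y + (twistU n).mulVec (w ((T * S)⁻¹ • y)) +
      (twistU n).mulVec ((twistU n).mulVec (w (((T * S)⁻¹) ^ 2 • y))) = 0) :
    ∑ x, invForm n ((twistP n).mulVec ((P (T⁻¹ • x) - (twistS n).mulVec (P (S⁻¹ • T⁻¹ • x)))) -
        (twistPinv n).mulVec ((P (T • x) - (twistS n).mulVec (P (S⁻¹ • T • x))))) (w x) = 0 := by
  have hPT' : ∀ x, P (T⁻¹ • x) = P x := fun x ↦ by
    conv_rhs => rw [← smul_inv_smul T x, hPT]
  -- `B(c, w) = Σ⟨c, v₁⟩ - Σ⟨c, v₂⟩`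
  have hadj1 := sum_invForm_twistP_smul hn (fun y ↦ P y - (twistS n).mulVec (P (S⁻¹ • y))) w
  have hadj2 := sum_invForm_twistPinv_smul hn (fun y ↦ P y - (twistS n).mulVec (P (S⁻¹ • y))) w
  simp only [map_sub, LinearMap.sub_apply, Finset.sum_sub_distrib] at hadj1 hadj2 ⊢
  rw [hadj1, hadj2]
  -- `Σ⟨σ_S P(S⁻¹y), v y⟩ = Σ⟨P y, σ_S v(S y)⟩` and the key identities
  rw [sum_invForm_twistS_smul hn P, sum_invForm_twistS_smul hn P]
  have hk := fun y ↦ key_identities hn w h2 h3 y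
  simp only [fun y ↦ (hk y).1, fun y ↦ (hk y).2, map_add, map_neg, Finset.sum_add_distrib,
    Finset.sum_neg_distrib]
  -- the `T`-shifts `Σ⟨P y, σ_T' w(Ty)⟩ = Σ⟨P, w⟩ = Σ⟨P y, σ_T w(T⁻¹y)⟩`
  have hs1 : ∑ y, invForm n (P y) ((twistPinv n).mulVec (w (T • y))) = ∑ x, invForm n (P x) (w x) := by
    rw [← sum_invForm_twistP_smul hn P w]
    refine Finset.sum_congr rfl fun x _ ↦ ?_
    rw [hPT', hPP]
  have hs2 : ∑ y, invForm n (P y) ((twistP n).mulVec (w (T⁻¹ • y))) = ∑ x, invForm n (P x) (w x) := by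
    rw [← sum_invForm_twistPinv_smul hn P w]
    refine Finset.sum_congr rfl fun x _ ↦ ?_
    rw [hPT, hPPinv]
  rw [hs1, hs2]
  ring

/-! ### The coboundary vectors `c^κ(x) = [x∞ = κ] δₙ - σ_S([S⁻¹x∞ = κ] δₙ)` -/

/-- `T` does not move the cusp at infinity of a coset: `(Tx)⁻¹∞ = x⁻¹∞`. [folklore] -/
theorem cuspInfty_T_smul (x : Gamma0Coset N) : cuspInfty N (T • x) = cuspInfty N x := by
  induction x using QuotientGroup.induction_on with
  | H h =>
    rw [MulAction.Quotient.smul_mk, smul_eq_mul, cuspInfty_mk, cuspInfty_mk, mul_inv_rev,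
      show (T⁻¹ : SL(2, ℤ)) = T ^ (-1 : ℤ) by rw [zpow_neg_one], cuspOrbitOf_mul_T_zpow]

open scoped Classical in
/-- **The pairing of an M-symbol with `c^κ` is its boundary at `κ`**:
`∑_x ∑_j m(x)ⱼ c^κ(x)ⱼ = δ(m)(κ)` (this is how `c^κ` is dual to the boundary map `bdryKMap`). [folklore] -/
theorem sum_mul_cobVec (m : Gamma0Coset N → Fin (n + 1) → ℚ)
    (κ : CuspOrbits (Gamma0 N : Subgroup (GL (Fin 2) ℝ))) :
    ∑ x, ∑ j, ((m x j : ℚ) : ℂ) *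
      (((if cuspInfty N x = κ then (1 : ℂ) else 0) • (Pi.single (Fin.last n) (1 : ℂ) : Fin (n + 1) → ℂ) -
        (twistS n).mulVec ((if cuspInfty N (S⁻¹ • x) = κ then (1 : ℂ) else 0) •
          (Pi.single (Fin.last n) (1 : ℂ) : Fin (n + 1) → ℂ))) j) = ((bdryKMap N n m κ : ℚ) : ℂ) := by
  have hlast0 : ∀ j : Fin (n + 1), (Pi.single (Fin.last n) (1 : ℂ) : Fin (n + 1) → ℂ) j =
      if j = Fin.last n then 1 else 0 := fun j ↦ by rw [Pi.single_apply]
  have hzero0 : ∀ j : Fin (n + 1), (Pi.single (0 : Fin (n + 1)) (1 : ℂ) : Fin (n + 1) → ℂ) j =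
      if j = 0 then 1 else 0 := fun j ↦ by rw [Pi.single_apply]
  -- the left-hand side, coset by coset
  have hL : ∀ x : Gamma0Coset N, ∑ j, ((m x j : ℚ) : ℂ) *
      (((if cuspInfty N x = κ then (1 : ℂ) else 0) • (Pi.single (Fin.last n) (1 : ℂ) : Fin (n + 1) → ℂ) -
        (twistS n).mulVec ((if cuspInfty N (S⁻¹ • x) = κ then (1 : ℂ) else 0) •
          (Pi.single (Fin.last n) (1 : ℂ) : Fin (n + 1) → ℂ))) j) =
      (if cuspInfty N x = κ then ((m x (Fin.last n) : ℚ) : ℂ) else 0) -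
        (if cuspInfty N (S⁻¹ • x) = κ then ((m x 0 : ℚ) : ℂ) else 0) := by
    intro x
    simp only [Matrix.mulVec_smul, twistS_mulVec_single_last, Pi.sub_apply, Pi.smul_apply, smul_eq_mul,
      hlast0, hzero0, mul_sub, Finset.sum_sub_distrib, mul_ite, mul_one, mul_zero]
    rw [Finset.sum_ite_eq' Finset.univ (Fin.last n), Finset.sum_ite_eq' Finset.univ (0 : Fin (n + 1))]
    simp only [Finset.mem_univ, if_true]
  simp_rw [hL]
  -- the right-hand side
  simp only [bdryKMap, LinearMap.coe_mk, AddHom.coe_mk, Finset.sum_apply, Pi.sub_apply, Pi.smul_apply,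
    Pi.single_apply, smul_eq_mul, mul_ite, mul_one, mul_zero]
  push_cast
  refine Finset.sum_congr rfl fun x _ ↦ ?_
  simp only [eq_comm (a := κ)]
  split_ifs <;> simp

open scoped Classical in
/-- **`c^κ` satisfies the period relations** (`C ⊆ W`): two-term `c + σ_S c(S⁻¹·) = 0` and
three-term `c + σ_U c(U⁻¹·) + σ_U² c(U⁻²·) = 0` (the cusps of the triangle,
`cuspInfty_three_term`, and `σ_U δ₀ = δₙ`, `σ_U δₙ = 𝟙`, `σ_U 𝟙 = δ₀`). [cite: PasolPopa2013, §2 (C_w^Γ ⊂ W_w^Γ) and Lemma 4.2] -/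
theorem cobVec_relations (hn : Even n) (κ : CuspOrbits (Gamma0 N : Subgroup (GL (Fin 2) ℝ))) :
    let c : Gamma0Coset N → Fin (n + 1) → ℂ := fun x ↦
      ((if cuspInfty N x = κ then (1 : ℂ) else 0) • (Pi.single (Fin.last n) (1 : ℂ) : Fin (n + 1) → ℂ) -
        (twistS n).mulVec ((if cuspInfty N (S⁻¹ • x) = κ then (1 : ℂ) else 0) •
          (Pi.single (Fin.last n) (1 : ℂ) : Fin (n + 1) → ℂ)))
    (∀ y, c y + (twistS n).mulVec (c (S⁻¹ • y)) = 0) ∧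
    (∀ y, c y + (twistU n).mulVec (c ((T * S)⁻¹ • y)) +
      (twistU n).mulVec ((twistU n).mulVec (c (((T * S)⁻¹) ^ 2 • y))) = 0) := by
  intro c
  have hSS : ∀ v : Fin (n + 1) → ℂ, (twistS n).mulVec ((twistS n).mulVec v) = v := fun v ↦ by
    rw [Matrix.mulVec_mulVec, twistS_mul_twistS hn, Matrix.one_mulVec]
  constructor
  · intro y
    simp only [c, Matrix.mulVec_sub, hSS, S_inv_smul_S_inv_smul]
    abel
  · intro y
    obtain ⟨c1, c2, c3⟩ := cuspInfty_three_term y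
    have e1 : (twistU n).mulVec (Pi.single (Fin.last n) (1 : ℂ)) = fun _ ↦ 1 := twistU_mulVec_single_last hn
    have e2 : (twistU n).mulVec (fun _ ↦ (1 : ℂ)) = Pi.single 0 1 := twistU_mulVec_one hn
    have e3 : (twistU n).mulVec (Pi.single 0 (1 : ℂ)) = Pi.single (Fin.last n) 1 := twistU_mulVec_single_zero hn
    simp only [c, Matrix.mulVec_sub, Matrix.mulVec_smul, twistS_mulVec_single_last, e1, e2, e3]
    rw [c1, c2, c3]
    abel

/-! ### A rational projection along the coboundary space -/

/-- A linear projection killing a family of vectors, with `v - Π v` in their span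
(projection onto a complement of the span). [folklore] -/
theorem exists_proj_along {V : Type*} [AddCommGroup V] [Module ℚ V] {ι : Type*} (c : ι → V) :
    ∃ Pr : V →ₗ[ℚ] V, (∀ i, Pr (c i) = 0) ∧ (∀ v, v - Pr v ∈ Submodule.span ℚ (Set.range c)) := by
  set C := Submodule.span ℚ (Set.range c)
  obtain ⟨D, hCD⟩ := C.exists_isCompl
  refine ⟨D.projection C hCD.symm, fun i ↦ ?_, fun v ↦ Submodule.sub_projection_mem hCD.symm v⟩
  exact Submodule.projection_apply_right hCD.symm ⟨c i, Submodule.subset_span ⟨i, rfl⟩⟩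

open scoped Classical in
/-- **Matrix form of a linear endomorphism of `X → Fin (n+1) → ℚ`**:
`(Π v)(x)ⱼ = ∑_{x', j'} Π(e_{x'} ⊗ e_{j'})(x)ⱼ v(x')_{j'}`. [folklore] -/
theorem proj_apply_eq_sum (Pr : (Gamma0Coset N → Fin (n + 1) → ℚ) →ₗ[ℚ] (Gamma0Coset N → Fin (n + 1) → ℚ))
    (v : Gamma0Coset N → Fin (n + 1) → ℚ) (x : Gamma0Coset N) (j : Fin (n + 1)) :
    Pr v x j = ∑ x', ∑ j', Pr (Pi.single x' (Pi.single j' 1)) x j * v x' j' := by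
  have hv : v = ∑ x', ∑ j', v x' j' • (Pi.single x' (Pi.single j' (1 : ℚ)) :
      Gamma0Coset N → Fin (n + 1) → ℚ) := by
    funext y k
    simp only [Finset.sum_apply, Pi.smul_apply, Pi.single_apply, smul_eq_mul]
    rw [Finset.sum_eq_single y (fun x' _ hx' ↦ by simp [Ne.symm hx']) (by simp)]
    simp only [if_true, Pi.single_apply, mul_ite, mul_one, mul_zero]
    rw [Finset.sum_ite_eq Finset.univ k]
    simp
  conv_lhs => rw [hv]
  simp only [map_sum, map_smul, Finset.sum_apply, Pi.smul_apply, smul_eq_mul]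
  refine Finset.sum_congr rfl fun x' _ ↦ Finset.sum_congr rfl fun j' _ ↦ ?_
  ring

/-! ### The `K`-structures `KΩ⁺ + KΩ⁻i` and `KΩ⁺² + KΩ⁻² + KΩ⁺Ω⁻i` -/

section Plane

variable {K : IntermediateField ℚ ℂ} {Ωp Ωm : ℝ}

/-- `0` lies in the plane `KΩ⁺ + KΩ⁻i`. [folklore] -/
theorem plane_zero : (∃ a b : ℂ, a ∈ K ∧ b ∈ K ∧ 0 = a * Ωp + b * (Ωm * I)) := ⟨0, 0, zero_mem _, zero_mem _, by ring⟩

/-- The plane `KΩ⁺ + KΩ⁻i` is closed under addition. [folklore] -/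
theorem plane_add {z w : ℂ} (hz : (∃ a b : ℂ, a ∈ K ∧ b ∈ K ∧ z = a * Ωp + b * (Ωm * I))) (hw : (∃ a b : ℂ, a ∈ K ∧ b ∈ K ∧ w = a * Ωp + b * (Ωm * I))) : (∃ a b : ℂ, a ∈ K ∧ b ∈ K ∧ (z + w) = a * Ωp + b * (Ωm * I)) := by
  obtain ⟨a, b, ha, hb, rfl⟩ := hz
  obtain ⟨a', b', ha', hb', rfl⟩ := hw
  exact ⟨a + a', b + b', add_mem ha ha', add_mem hb hb', by ring⟩

/-- The plane `KΩ⁺ + KΩ⁻i` is closed under multiplication by `K`. [folklore] -/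
theorem plane_mul_left {z k : ℂ} (hk : k ∈ K) (hz : (∃ a b : ℂ, a ∈ K ∧ b ∈ K ∧ z = a * Ωp + b * (Ωm * I))) : (∃ a b : ℂ, a ∈ K ∧ b ∈ K ∧ (k * z) = a * Ωp + b * (Ωm * I)) := by
  obtain ⟨a, b, ha, hb, rfl⟩ := hz
  exact ⟨k * a, k * b, mul_mem hk ha, mul_mem hk hb, by ring⟩

/-- The plane `KΩ⁺ + KΩ⁻i` is closed under negation. [folklore] -/
theorem plane_neg {z : ℂ} (hz : (∃ a b : ℂ, a ∈ K ∧ b ∈ K ∧ z = a * Ωp + b * (Ωm * I))) : (∃ a b : ℂ, a ∈ K ∧ b ∈ K ∧ (-z) = a * Ωp + b * (Ωm * I)) := by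
  have := plane_mul_left (K := K) (neg_mem (one_mem K) : (-1 : ℂ) ∈ K) hz
  simpa using this

/-- The plane `KΩ⁺ + KΩ⁻i` is closed under subtraction. [folklore] -/
theorem plane_sub {z w : ℂ} (hz : (∃ a b : ℂ, a ∈ K ∧ b ∈ K ∧ z = a * Ωp + b * (Ωm * I))) (hw : (∃ a b : ℂ, a ∈ K ∧ b ∈ K ∧ w = a * Ωp + b * (Ωm * I))) : (∃ a b : ℂ, a ∈ K ∧ b ∈ K ∧ (z - w) = a * Ωp + b * (Ωm * I)) := by
  rw [sub_eq_add_neg]; exact plane_add hz (plane_neg hw)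

/-- The plane `KΩ⁺ + KΩ⁻i` is closed under finite sums. [folklore] -/
theorem plane_sum {ι : Type*} (s : Finset ι) {g : ι → ℂ} (h : ∀ i ∈ s, (∃ a b : ℂ, a ∈ K ∧ b ∈ K ∧ (g i) = a * Ωp + b * (Ωm * I))) :
    (∃ a b : ℂ, a ∈ K ∧ b ∈ K ∧ (∑ i ∈ s, g i) = a * Ωp + b * (Ωm * I)) := by
  classical
  induction s using Finset.induction_on with
  | empty => simpa using (plane_zero : (∃ a b : ℂ, a ∈ K ∧ b ∈ K ∧ 0 = a * Ωp + b * (Ωm * I)))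
  | insert a s has ih =>
    rw [Finset.sum_insert has]
    exact plane_add (h a (Finset.mem_insert_self a s)) (ih fun i hi ↦ h i (Finset.mem_insert_of_mem hi))

/-- `0` lies in `KΩ⁺² + KΩ⁻² + KΩ⁺Ω⁻i`. [folklore] -/
theorem quad_zero : (∃ a b c : ℂ, a ∈ K ∧ b ∈ K ∧ c ∈ K ∧ 0 = a * Ωp ^ 2 + b * Ωm ^ 2 + c * (Ωp * Ωm * I)) := ⟨0, 0, 0, zero_mem _, zero_mem _, zero_mem _, by ring⟩

/-- `KΩ⁺² + KΩ⁻² + KΩ⁺Ω⁻i` is closed under addition. [folklore] -/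
theorem quad_add {z w : ℂ} (hz : (∃ a b c : ℂ, a ∈ K ∧ b ∈ K ∧ c ∈ K ∧ z = a * Ωp ^ 2 + b * Ωm ^ 2 + c * (Ωp * Ωm * I))) (hw : (∃ a b c : ℂ, a ∈ K ∧ b ∈ K ∧ c ∈ K ∧ w = a * Ωp ^ 2 + b * Ωm ^ 2 + c * (Ωp * Ωm * I))) : (∃ a b c : ℂ, a ∈ K ∧ b ∈ K ∧ c ∈ K ∧ (z + w) = a * Ωp ^ 2 + b * Ωm ^ 2 + c * (Ωp * Ωm * I)) := by
  obtain ⟨a, b, c, ha, hb, hc, rfl⟩ := hz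
  obtain ⟨a', b', c', ha', hb', hc', rfl⟩ := hw
  exact ⟨a + a', b + b', c + c', add_mem ha ha', add_mem hb hb', add_mem hc hc', by ring⟩

/-- `KΩ⁺² + KΩ⁻² + KΩ⁺Ω⁻i` is closed under multiplication by `K`. [folklore] -/
theorem quad_mul_left {z k : ℂ} (hk : k ∈ K) (hz : (∃ a b c : ℂ, a ∈ K ∧ b ∈ K ∧ c ∈ K ∧ z = a * Ωp ^ 2 + b * Ωm ^ 2 + c * (Ωp * Ωm * I))) : (∃ a b c : ℂ, a ∈ K ∧ b ∈ K ∧ c ∈ K ∧ (k * z) = a * Ωp ^ 2 + b * Ωm ^ 2 + c * (Ωp * Ωm * I)) := by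
  obtain ⟨a, b, c, ha, hb, hc, rfl⟩ := hz
  exact ⟨k * a, k * b, k * c, mul_mem hk ha, mul_mem hk hb, mul_mem hk hc, by ring⟩

/-- `KΩ⁺² + KΩ⁻² + KΩ⁺Ω⁻i` is closed under finite sums. [folklore] -/
theorem quad_sum {ι : Type*} (s : Finset ι) {g : ι → ℂ} (h : ∀ i ∈ s, (∃ a b c : ℂ, a ∈ K ∧ b ∈ K ∧ c ∈ K ∧ (g i) = a * Ωp ^ 2 + b * Ωm ^ 2 + c * (Ωp * Ωm * I))) :
    (∃ a b c : ℂ, a ∈ K ∧ b ∈ K ∧ c ∈ K ∧ (∑ i ∈ s, g i) = a * Ωp ^ 2 + b * Ωm ^ 2 + c * (Ωp * Ωm * I)) := by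
  classical
  induction s using Finset.induction_on with
  | empty => simpa using (quad_zero : (∃ a b c : ℂ, a ∈ K ∧ b ∈ K ∧ c ∈ K ∧ 0 = a * Ωp ^ 2 + b * Ωm ^ 2 + c * (Ωp * Ωm * I)))
  | insert a s has ih =>
    rw [Finset.sum_insert has]
    exact quad_add (h a (Finset.mem_insert_self a s)) (ih fun i hi ↦ h i (Finset.mem_insert_of_mem hi))

/-- `(aΩ⁺ + bΩ⁻i) · \overline{(a'Ω⁺ + b'Ω⁻i)} ∈ KΩ⁺² + KΩ⁻² + KΩ⁺Ω⁻i` when `K` is real. [folklore] -/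
theorem plane_mul_conj (hK : ∀ k : ℂ, k ∈ K → conj k = k) {z w : ℂ} (hz : (∃ a b : ℂ, a ∈ K ∧ b ∈ K ∧ z = a * Ωp + b * (Ωm * I)))
    (hw : (∃ a b : ℂ, a ∈ K ∧ b ∈ K ∧ w = a * Ωp + b * (Ωm * I))) : (∃ a b c : ℂ, a ∈ K ∧ b ∈ K ∧ c ∈ K ∧ (z * conj w) = a * Ωp ^ 2 + b * Ωm ^ 2 + c * (Ωp * Ωm * I)) := by
  obtain ⟨a, b, ha, hb, rfl⟩ := hz
  obtain ⟨a', b', ha', hb', rfl⟩ := hw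
  refine ⟨a * a', b * b', b * a' - a * b', mul_mem ha ha', mul_mem hb hb',
    sub_mem (mul_mem hb ha') (mul_mem ha hb'), ?_⟩
  simp only [map_add, map_mul, Complex.conj_ofReal, Complex.conj_I, hK a' ha', hK b' hb']
  linear_combination (-(b * (Ωm : ℂ) ^ 2 * b')) * Complex.I_sq

end Plane

section Coordinates

variable {K : IntermediateField ℚ ℂ} {Ωp Ωm : ℝ}

/-- Natural-number casts lie in `K`. [folklore] -/
theorem natCast_mem_K (m : ℕ) : (m : ℂ) ∈ K := by
  have h : ((m : ℚ) : ℂ) ∈ K := K.algebraMap_mem (m : ℚ)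
  rw [Rat.cast_natCast] at h
  exact h

/-- `σ_T` preserves vectors with coordinates in the plane. [folklore] -/
theorem plane_twistP {y : Fin (n + 1) → ℂ} (hy : ∀ j, (∃ a b : ℂ, a ∈ K ∧ b ∈ K ∧ (y j) = a * Ωp + b * (Ωm * I))) (j : Fin (n + 1)) :
    (∃ a b : ℂ, a ∈ K ∧ b ∈ K ∧ ((twistP n).mulVec y j) = a * Ωp + b * (Ωm * I)) := by
  rw [twistP_mulVec]
  refine plane_sum _ fun i _ ↦ ?_
  split_ifs
  · exact plane_mul_left (natCast_mem_K _) (hy i)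
  · rw [zero_mul]; exact plane_zero

/-- `σ_T'` preserves vectors with coordinates in the plane. [folklore] -/
theorem plane_twistPinv {y : Fin (n + 1) → ℂ} (hy : ∀ j, (∃ a b : ℂ, a ∈ K ∧ b ∈ K ∧ (y j) = a * Ωp + b * (Ωm * I))) (j : Fin (n + 1)) :
    (∃ a b : ℂ, a ∈ K ∧ b ∈ K ∧ ((twistPinv n).mulVec y j) = a * Ωp + b * (Ωm * I)) := by
  rw [twistPinv_mulVec]
  refine plane_sum _ fun i _ ↦ ?_
  split_ifs
  · refine plane_mul_left (mul_mem ?_ (natCast_mem_K _)) (hy i)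
    exact pow_mem (neg_mem (one_mem K)) _
  · rw [zero_mul]; exact plane_zero

/-- **The pairing of a plane vector with the conjugate of a plane vector lies in
`KΩ⁺² + KΩ⁻² + KΩ⁺Ω⁻i`.** [folklore] -/
theorem plane_invForm (hK : ∀ k : ℂ, k ∈ K → conj k = k) {v w : Fin (n + 1) → ℂ}
    (hv : ∀ j, (∃ a b : ℂ, a ∈ K ∧ b ∈ K ∧ (v j) = a * Ωp + b * (Ωm * I))) (hw : ∀ j, (∃ a b : ℂ, a ∈ K ∧ b ∈ K ∧ (w j) = a * Ωp + b * (Ωm * I))) :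
    (∃ a b c : ℂ, a ∈ K ∧ b ∈ K ∧ c ∈ K ∧ (invForm n v (fun j ↦ conj (w j))) = a * Ωp ^ 2 + b * Ωm ^ 2 + c * (Ωp * Ωm * I)) := by
  rw [invForm_apply]
  refine quad_sum _ fun j _ ↦ ?_
  rw [mul_assoc]
  refine quad_mul_left (mul_mem (pow_mem (neg_mem (one_mem K)) _) (natCast_mem_K _)) ?_
  exact plane_mul_conj hK (hv j) (hw _)

end Coordinates

/-! ### Period relations of the M-symbol vector of a cusp form and of its conjugate -/

section Relations

/-- **The M-symbol vector `R_f(x)ⱼ = msymbK n x j f` of a cusp form satisfies the period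
relations** (two-term and three-term; `msymbK_two_term`, `msymbK_three_term`), and so does its
complex conjugate. [folklore] -/
theorem msymbK_vec_relations (hn : Even n) (f : CuspForm (Gamma0 N) (n + 2)) :
    let R : Gamma0Coset N → Fin (n + 1) → ℂ := fun x j ↦ msymbK n x j f
    ((∀ y, R y + (twistS n).mulVec (R (S⁻¹ • y)) = 0) ∧
     (∀ y, R y + (twistU n).mulVec (R ((T * S)⁻¹ • y)) +
       (twistU n).mulVec ((twistU n).mulVec (R (((T * S)⁻¹) ^ 2 • y))) = 0)) ∧
    ((∀ y, (fun j ↦ conj (R y j)) + (twistS n).mulVec (fun j ↦ conj (R (S⁻¹ • y) j)) = 0) ∧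
     (∀ y, (fun j ↦ conj (R y j)) + (twistU n).mulVec (fun j ↦ conj (R ((T * S)⁻¹ • y) j)) +
       (twistU n).mulVec ((twistU n).mulVec (fun j ↦ conj (R (((T * S)⁻¹) ^ 2 • y) j))) = 0)) := by
  intro R
  have h2 : ∀ y, R y + (twistS n).mulVec (R (S⁻¹ • y)) = 0 := by
    intro y
    funext j
    have := congrArg (fun φ ↦ φ f) (msymbK_two_term n hn y j)
    simp only [LinearMap.add_apply, LinearMap.zero_apply, matAct_apply, twistS_map] at this
    exact this
  have h3 : ∀ y, R y + (twistU n).mulVec (R ((T * S)⁻¹ • y)) +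
      (twistU n).mulVec ((twistU n).mulVec (R (((T * S)⁻¹) ^ 2 • y))) = 0 := by
    intro y
    funext j
    have := congrArg (fun φ ↦ φ f) (msymbK_three_term n hn y j)
    simp only [LinearMap.add_apply, LinearMap.zero_apply, matAct_apply, twistU_map] at this
    exact this
  refine ⟨⟨h2, h3⟩, fun y ↦ ?_, fun y ↦ ?_⟩
  · have := congrArg (fun v : Fin (n + 1) → ℂ ↦ fun j ↦ conj (v j)) (h2 y)
    simp only [Pi.add_apply, map_add, Pi.zero_apply, map_zero] at this
    rw [← conj_twistS_mulVec]
    exact this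
  · have := congrArg (fun v : Fin (n + 1) → ℂ ↦ fun j ↦ conj (v j)) (h3 y)
    simp only [Pi.add_apply, map_add, Pi.zero_apply, map_zero] at this
    rw [← conj_twistU_mulVec, ← conj_twistU_mulVec, ← conj_twistU_mulVec]
    exact this

end Relations

/-! ### The complex coboundary space `C_ℂ = span{c^κ}`: relations and Lemma 4.1 for its elements -/

section SpanC

open scoped Classical in
/-- Elements of `C_ℂ = span_ℂ{c^κ}` satisfy the period relations. [cite: PasolPopa2013, §2 (C_w^Γ ⊂ W_w^Γ)] -/
theorem span_cobVec_relations (hn : Even n) {c : Gamma0Coset N → Fin (n + 1) → ℂ}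
    (hc : c ∈ Submodule.span ℂ (Set.range fun κ : CuspOrbits (Gamma0 N : Subgroup (GL (Fin 2) ℝ)) ↦
      fun x : Gamma0Coset N ↦
        ((if cuspInfty N x = κ then (1 : ℂ) else 0) • (Pi.single (Fin.last n) (1 : ℂ) : Fin (n + 1) → ℂ) -
          (twistS n).mulVec ((if cuspInfty N (S⁻¹ • x) = κ then (1 : ℂ) else 0) •
            (Pi.single (Fin.last n) (1 : ℂ) : Fin (n + 1) → ℂ))))) :
    (∀ y, c y + (twistS n).mulVec (c (S⁻¹ • y)) = 0) ∧
    (∀ y, c y + (twistU n).mulVec (c ((T * S)⁻¹ • y)) +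
      (twistU n).mulVec ((twistU n).mulVec (c (((T * S)⁻¹) ^ 2 • y))) = 0) := by
  induction hc using Submodule.span_induction with
  | mem x hx =>
    obtain ⟨κ, rfl⟩ := hx
    exact cobVec_relations hn κ
  | zero => constructor <;> intro y <;> simp
  | add x y _ _ hx hy =>
    refine ⟨fun z ↦ ?_, fun z ↦ ?_⟩
    · have h1 := hx.1 z; have h2 := hy.1 z
      simp only [Pi.add_apply, Matrix.mulVec_add]
      rw [add_add_add_comm, h1, h2, add_zero]
    · have h1 := hx.2 z; have h2 := hy.2 z
      simp only [Pi.add_apply, Matrix.mulVec_add]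
      calc _ = (x z + (twistU n).mulVec (x ((T * S)⁻¹ • z)) +
            (twistU n).mulVec ((twistU n).mulVec (x (((T * S)⁻¹) ^ 2 • z)))) +
          (y z + (twistU n).mulVec (y ((T * S)⁻¹ • z)) +
            (twistU n).mulVec ((twistU n).mulVec (y (((T * S)⁻¹) ^ 2 • z)))) := by abel
        _ = 0 := by rw [h1, h2, add_zero]
  | smul a x _ hx =>
    refine ⟨fun z ↦ ?_, fun z ↦ ?_⟩
    · have h1 := hx.1 z
      simp only [Pi.smul_apply, Matrix.mulVec_smul, ← smul_add, h1, smul_zero]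
    · have h1 := hx.2 z
      simp only [Pi.smul_apply, Matrix.mulVec_smul, ← smul_add, h1, smul_zero]

open scoped Classical in
/-- **Lemma 4.1 for `C_ℂ`**: `B(c, w) = 0` for `c ∈ span_ℂ{c^κ}` and `w` satisfying the period
relations. [cite: PasolPopa2013, Lemma 4.1] -/
theorem span_cobVec_pairing_left (hn : Even n) (w : Gamma0Coset N → Fin (n + 1) → ℂ)
    (h2 : ∀ y, w y + (twistS n).mulVec (w (S⁻¹ • y)) = 0)
    (h3 : ∀ y, w y + (twistU n).mulVec (w ((T * S)⁻¹ • y)) +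
      (twistU n).mulVec ((twistU n).mulVec (w (((T * S)⁻¹) ^ 2 • y))) = 0)
    {c : Gamma0Coset N → Fin (n + 1) → ℂ}
    (hc : c ∈ Submodule.span ℂ (Set.range fun κ : CuspOrbits (Gamma0 N : Subgroup (GL (Fin 2) ℝ)) ↦
      fun x : Gamma0Coset N ↦
        ((if cuspInfty N x = κ then (1 : ℂ) else 0) • (Pi.single (Fin.last n) (1 : ℂ) : Fin (n + 1) → ℂ) -
          (twistS n).mulVec ((if cuspInfty N (S⁻¹ • x) = κ then (1 : ℂ) else 0) •
            (Pi.single (Fin.last n) (1 : ℂ) : Fin (n + 1) → ℂ))))) :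
    ∑ x, invForm n ((twistP n).mulVec (c (T⁻¹ • x)) - (twistPinv n).mulVec (c (T • x))) (w x) = 0 := by
  induction hc using Submodule.span_induction with
  | mem x hx =>
    obtain ⟨κ, rfl⟩ := hx
    have hP := haberlandForm_coboundary_left hn
      (fun y : Gamma0Coset N ↦ (if cuspInfty N y = κ then (1 : ℂ) else 0) •
        (Pi.single (Fin.last n) (1 : ℂ) : Fin (n + 1) → ℂ)) w
      (fun y ↦ by simp only [cuspInfty_T_smul])
      (fun y ↦ by rw [Matrix.mulVec_smul, twistP_mulVec_single_last])
      (fun y ↦ by rw [Matrix.mulVec_smul, twistPinv_mulVec_single_last]) h2 h3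
    simpa using hP
  | zero => simp
  | add x y _ _ hx hy =>
    simp only [Pi.add_apply, Matrix.mulVec_add, map_add, map_sub, LinearMap.add_apply,
      LinearMap.sub_apply, Finset.sum_add_distrib, Finset.sum_sub_distrib] at hx hy ⊢
    linear_combination hx + hy
  | smul a x _ hx =>
    simp only [Pi.smul_apply, Matrix.mulVec_smul, map_sub, map_smul, LinearMap.sub_apply,
      LinearMap.smul_apply, smul_eq_mul, Finset.sum_sub_distrib, ← Finset.mul_sum] at hx ⊢
    linear_combination a * hx

end SpanC

/-! ### A rational projection along `C`, complexified -/

section Projection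

open scoped Classical in
/-- **A rational projection along the coboundary space, complexified**: a rational matrix `M`
whose rows have zero boundary (`δ(M_{x,j}) = 0`, i.e. `Π(c^κ) = 0`) and such that `u - Πu` lies in
`C_ℂ = span_ℂ{c^κ}` for every complex vector `u` (`Πu = M u` is the projection onto a complement
of `C` along `C`). [folklore] -/
theorem exists_complex_proj :
    ∃ M : Gamma0Coset N → Fin (n + 1) → Gamma0Coset N → Fin (n + 1) → ℚ,
      (∀ x j, bdryKMap N n (M x j) = 0) ∧
      (∀ u : Gamma0Coset N → Fin (n + 1) → ℂ,
        (fun x j ↦ u x j - ∑ x', ∑ j', ((M x j x' j' : ℚ) : ℂ) * u x' j') ∈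
          Submodule.span ℂ (Set.range fun κ : CuspOrbits (Gamma0 N : Subgroup (GL (Fin 2) ℝ)) ↦
            fun x : Gamma0Coset N ↦
              ((if cuspInfty N x = κ then (1 : ℂ) else 0) • (Pi.single (Fin.last n) (1 : ℂ) : Fin (n + 1) → ℂ) -
                (twistS n).mulVec ((if cuspInfty N (S⁻¹ • x) = κ then (1 : ℂ) else 0) •
                  (Pi.single (Fin.last n) (1 : ℂ) : Fin (n + 1) → ℂ))))) := by
  haveI : Fintype (CuspOrbits (Gamma0 N : Subgroup (GL (Fin 2) ℝ))) := Fintype.ofFinite _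
  set cobQ : CuspOrbits (Gamma0 N : Subgroup (GL (Fin 2) ℝ)) → Gamma0Coset N → Fin (n + 1) → ℚ :=
    fun κ x ↦ (if cuspInfty N x = κ then (1 : ℚ) else 0) • (Pi.single (Fin.last n) (1 : ℚ) : Fin (n + 1) → ℚ) -
      (twistS n).mulVec ((if cuspInfty N (S⁻¹ • x) = κ then (1 : ℚ) else 0) •
        (Pi.single (Fin.last n) (1 : ℚ) : Fin (n + 1) → ℚ)) with hcobQ
  set cobC : CuspOrbits (Gamma0 N : Subgroup (GL (Fin 2) ℝ)) → Gamma0Coset N → Fin (n + 1) → ℂ :=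
    fun κ x ↦ (if cuspInfty N x = κ then (1 : ℂ) else 0) • (Pi.single (Fin.last n) (1 : ℂ) : Fin (n + 1) → ℂ) -
      (twistS n).mulVec ((if cuspInfty N (S⁻¹ • x) = κ then (1 : ℂ) else 0) •
        (Pi.single (Fin.last n) (1 : ℂ) : Fin (n + 1) → ℂ)) with hcobC
  have hcast : ∀ κ x j, ((cobQ κ x j : ℚ) : ℂ) = cobC κ x j := by
    intro κ x j
    simp only [hcobQ, hcobC, Pi.sub_apply, Pi.smul_apply, smul_eq_mul, twistS_mulVec, Pi.single_apply]
    push_cast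
    split_ifs <;> simp
  obtain ⟨Pr, hPr0, hPrC⟩ := exists_proj_along cobQ
  refine ⟨fun x j x' j' ↦ Pr (Pi.single x' (Pi.single j' 1)) x j, fun x j ↦ ?_, fun u ↦ ?_⟩
  · funext κ
    have h := sum_mul_cobVec (n := n) (fun x' j' ↦ Pr (Pi.single x' (Pi.single j' 1)) x j) κ
    have h2 : ∑ x', ∑ j', ((Pr (Pi.single x' (Pi.single j' 1)) x j : ℚ) : ℂ) * cobC κ x' j' =
        ((Pr (cobQ κ) x j : ℚ) : ℂ) := by
      rw [proj_apply_eq_sum Pr (cobQ κ) x j]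
      push_cast
      simp only [hcast]
    rw [hPr0] at h2
    simp only [Pi.zero_apply, Rat.cast_zero] at h2
    have h3 : ((bdryKMap N n (fun x' j' ↦ Pr (Pi.single x' (Pi.single j' 1)) x j) κ : ℚ) : ℂ) = 0 :=
      h.symm.trans h2
    exact_mod_cast h3
  · -- `D_{x',j'} = e_{x',j'} - Π e_{x',j'} ∈ C_ℂ`
    have hD : ∀ x' j', (fun x j ↦ (((Pi.single x' (Pi.single j' (1 : ℚ)) : Gamma0Coset N → Fin (n + 1) → ℚ) x j : ℚ) : ℂ) -
        ((Pr (Pi.single x' (Pi.single j' 1)) x j : ℚ) : ℂ)) ∈ Submodule.span ℂ (Set.range cobC) := by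
      intro x' j'
      obtain ⟨r, hr⟩ := (Submodule.mem_span_range_iff_exists_fun ℚ).mp (hPrC (Pi.single x' (Pi.single j' 1)))
      have hfun : (fun x j ↦ (((Pi.single x' (Pi.single j' (1 : ℚ)) : Gamma0Coset N → Fin (n + 1) → ℚ) x j : ℚ) : ℂ) -
          ((Pr (Pi.single x' (Pi.single j' 1)) x j : ℚ) : ℂ)) = ∑ κ, (r κ : ℂ) • cobC κ := by
        funext x j
        have hxj := congrFun (congrFun hr x) j
        simp only [Finset.sum_apply, Pi.smul_apply, Pi.sub_apply, smul_eq_mul] at hxj ⊢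
        rw [← Rat.cast_sub, ← hxj]
        push_cast
        simp only [hcast]
      rw [hfun]
      exact Submodule.sum_mem _ fun κ _ ↦ Submodule.smul_mem _ _ (Submodule.subset_span ⟨κ, rfl⟩)
    have hsum : (fun x j ↦ u x j - ∑ x', ∑ j', ((Pr (Pi.single x' (Pi.single j' 1)) x j : ℚ) : ℂ) * u x' j') =
        ∑ x', ∑ j', u x' j' • (fun x j ↦
          (((Pi.single x' (Pi.single j' (1 : ℚ)) : Gamma0Coset N → Fin (n + 1) → ℚ) x j : ℚ) : ℂ) -
            ((Pr (Pi.single x' (Pi.single j' 1)) x j : ℚ) : ℂ)) := by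
      funext x j
      simp only [Finset.sum_apply, Pi.smul_apply, smul_eq_mul, mul_sub, Finset.sum_sub_distrib]
      congr 1
      · simp only [Pi.single_apply]
        rw [Finset.sum_eq_single x (fun x' _ hx' ↦ by simp [Ne.symm hx']) (by simp)]
        simp only [if_true, Pi.single_apply, apply_ite (Rat.cast : ℚ → ℂ), Rat.cast_one, Rat.cast_zero,
          mul_ite, mul_one, mul_zero]
        rw [Finset.sum_ite_eq Finset.univ j]
        simp
      · refine Finset.sum_congr rfl fun x' _ ↦ Finset.sum_congr rfl fun j' _ ↦ ?_
        ring
    rw [hsum]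
    exact Submodule.sum_mem _ fun x' _ ↦ Submodule.sum_mem _ fun j' _ ↦ Submodule.smul_mem _ _ (hD x' j')

end Projection

/-! ### The Haberland form of a newform with itself lies in `KΩ⁺² + KΩ⁻² + KΩ⁺Ω⁻i` -/

section Main

/-- Additivity of the Haberland form in the first argument. [folklore] -/
theorem haberlandForm_add_left (a b w : Gamma0Coset N → Fin (n + 1) → ℂ) :
    ∑ x, invForm n ((twistP n).mulVec ((a + b) (T⁻¹ • x)) - (twistPinv n).mulVec ((a + b) (T • x))) (w x) =
      ∑ x, invForm n ((twistP n).mulVec (a (T⁻¹ • x)) - (twistPinv n).mulVec (a (T • x))) (w x) +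
      ∑ x, invForm n ((twistP n).mulVec (b (T⁻¹ • x)) - (twistPinv n).mulVec (b (T • x))) (w x) := by
  rw [← Finset.sum_add_distrib]
  refine Finset.sum_congr rfl fun x _ ↦ ?_
  rw [Pi.add_apply, Pi.add_apply, Matrix.mulVec_add, Matrix.mulVec_add, ← LinearMap.add_apply, ← map_add]
  congr 1
  abel

/-- Additivity of the Haberland form in the second argument. [folklore] -/
theorem haberlandForm_add_right (a v w : Gamma0Coset N → Fin (n + 1) → ℂ) :
    ∑ x, invForm n ((twistP n).mulVec (a (T⁻¹ • x)) - (twistPinv n).mulVec (a (T • x))) ((v + w) x) =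
      ∑ x, invForm n ((twistP n).mulVec (a (T⁻¹ • x)) - (twistPinv n).mulVec (a (T • x))) (v x) +
      ∑ x, invForm n ((twistP n).mulVec (a (T⁻¹ • x)) - (twistPinv n).mulVec (a (T • x))) (w x) := by
  rw [← Finset.sum_add_distrib]
  refine Finset.sum_congr rfl fun x _ ↦ ?_
  rw [Pi.add_apply, map_add]

open scoped Classical in
/-- **The Haberland form of the M-symbol vector of a newform with its conjugate lies in
`K_fΩ⁺² + K_fΩ⁻² + K_fΩ⁺Ω⁻i`** (Paşol–Popa, proof of Prop. 5.11(b) from (a) and Thm. 3.3, here via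
Lemma 4.1: the coboundary space is in the radical of the pairing, so only the cuspidal
coordinates of `R_f` — which lie in `K_fΩ⁺ + K_fΩ⁻i` (`exists_periods_criticalValues'`) — matter). [cite: PasolPopa2013, Prop. 5.11(b) (proof) and Lemma 4.1] -/
theorem haberlandForm_self_inQuad (hn : Even n) (hn0 : n ≠ 0) {f : CuspForm (Gamma0 N) (n + 2)}
    (hf : IsNewform0 f) {Ωp Ωm : ℝ}
    (hΩ : ∀ φ ∈ cuspidalLatticeK (N := N) n, ∃ a b : ℂ, a ∈ coeffField f ∧ b ∈ coeffField f ∧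
      φ f = a * Ωp + b * Ωm * I) :
    (∃ a b c : ℂ, a ∈ (coeffField f) ∧ b ∈ (coeffField f) ∧ c ∈ (coeffField f) ∧ (∑ x : Gamma0Coset N, invForm n
      ((twistP n).mulVec (fun j ↦ msymbK n (T⁻¹ • x) j f) - (twistPinv n).mulVec (fun j ↦ msymbK n (T • x) j f))
      (fun j ↦ conj (msymbK n x j f))) = a * Ωp ^ 2 + b * Ωm ^ 2 + c * (Ωp * Ωm * I)) := by
  set K : IntermediateField ℚ ℂ := coeffField f with hKdef
  have hK : ∀ k : ℂ, k ∈ K → conj k = k := fun k hk ↦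
    Complex.conj_eq_iff_im.mpr (hf.im_eq_zero_of_mem_coeffField hk)
  set R : Gamma0Coset N → Fin (n + 1) → ℂ := fun x j ↦ msymbK n x j f with hR
  obtain ⟨⟨hR2, hR3⟩, hRc2, hRc3⟩ := msymbK_vec_relations hn f
  -- the plane property of rational cuspidal classes
  have hplane : ∀ ψ ∈ Submodule.span ℚ (cuspidalLatticeK (N := N) n :
      Set (Module.Dual ℂ (CuspForm (Gamma0 N) (n + 2)))), (∃ a b : ℂ, a ∈ K ∧ b ∈ K ∧ (ψ f) = a * Ωp + b * (Ωm * I)) := by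
    have key : ∀ z ∈ Submodule.span K
        ((fun φ : Module.Dual ℂ (CuspForm (Gamma0 N) (n + 2)) ↦ φ f) '' (cuspidalLatticeK (N := N) n)),
        (∃ a b : ℂ, a ∈ K ∧ b ∈ K ∧ z = a * Ωp + b * (Ωm * I)) := by
      intro z hz
      induction hz using Submodule.span_induction with
      | mem z hz =>
        obtain ⟨φ, hφ, rfl⟩ := hz
        obtain ⟨a, b, ha, hb, hab⟩ := hΩ φ hφ
        exact ⟨a, b, ha, hb, by simp only [hab]; ring⟩
      | zero => exact plane_zero
      | add z w _ _ hz hw => exact plane_add hz hw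
      | smul k z _ hz =>
        rw [IntermediateField.smul_def, smul_eq_mul]
        exact plane_mul_left k.2 hz
    intro ψ hψ
    exact key _ (apply_mem_span_of_mem_span_cuspidalLatticeK hψ K f)
  -- the projection
  obtain ⟨M, hMδ, hMC⟩ := exists_complex_proj (N := N) (n := n)
  set u' : Gamma0Coset N → Fin (n + 1) → ℂ := fun x j ↦ ∑ x', ∑ j', ((M x j x' j' : ℚ) : ℂ) * R x' j' with hu'
  -- coordinates of `u' = Π R` lie in the plane
  have hu'plane : ∀ x j, (∃ a b : ℂ, a ∈ K ∧ b ∈ K ∧ (u' x j) = a * Ωp + b * (Ωm * I)) := by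
    intro x j
    have hmem : msymbKMap N n (M x j) ∈ Submodule.span ℚ (cuspidalLatticeK (N := N) n :
        Set (Module.Dual ℂ (CuspForm (Gamma0 N) (n + 2)))) := by
      rw [span_cuspidalLatticeK_eq_map_ker hn hn0]
      exact ⟨M x j, hMδ x j, rfl⟩
    have h := hplane _ hmem
    have heq : msymbKMap N n (M x j) f = u' x j := by
      simp only [msymbKMap, LinearMap.coe_mk, AddHom.coe_mk, LinearMap.coe_sum, Finset.sum_apply,
        LinearMap.smul_apply, hu', hR, Rat.smul_def]
    rwa [heq] at h
  -- `cu = R - ΠR ∈ C_ℂ`, and the conjugate side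
  set cu : Gamma0Coset N → Fin (n + 1) → ℂ :=
    fun x j ↦ R x j - ∑ x', ∑ j', ((M x j x' j' : ℚ) : ℂ) * R x' j' with hcu_def
  have hcu := hMC R
  set Rc : Gamma0Coset N → Fin (n + 1) → ℂ := fun x j ↦ conj (R x j) with hRc
  set ū' : Gamma0Coset N → Fin (n + 1) → ℂ := fun x j ↦ ∑ x', ∑ j', ((M x j x' j' : ℚ) : ℂ) * Rc x' j' with hū'
  set cū : Gamma0Coset N → Fin (n + 1) → ℂ :=
    fun x j ↦ Rc x j - ∑ x', ∑ j', ((M x j x' j' : ℚ) : ℂ) * Rc x' j' with hcū_def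
  have hcū := hMC Rc
  have hū'conj : ū' = fun x j ↦ conj (u' x j) := by
    funext x j
    simp only [hū', hu', hRc, map_sum, map_mul, map_ratCast]
  -- decompositions
  have hRu : R = u' + cu := by
    funext x j; simp only [Pi.add_apply, hcu_def, hu']; ring
  have hRcū : Rc = ū' + cū := by
    funext x j; simp only [Pi.add_apply, hcū_def, hū']; ring
  have hu'eq : ∀ y, u' y = R y - cu y := fun y ↦ by
    funext j; simp only [Pi.sub_apply, hcu_def, hu']; ring
  have hū'eq : ∀ y, ū' y = Rc y - cū y := fun y ↦ by
    funext j; simp only [Pi.sub_apply, hcū_def, hū']; ring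
  -- relations
  have hR2' : ∀ y, R y + (twistS n).mulVec (R (S⁻¹ • y)) = 0 := hR2
  have hR3' : ∀ y, R y + (twistU n).mulVec (R ((T * S)⁻¹ • y)) +
      (twistU n).mulVec ((twistU n).mulVec (R (((T * S)⁻¹) ^ 2 • y))) = 0 := hR3
  have hRc2' : ∀ y, Rc y + (twistS n).mulVec (Rc (S⁻¹ • y)) = 0 := hRc2
  have hRc3' : ∀ y, Rc y + (twistU n).mulVec (Rc ((T * S)⁻¹ • y)) +
      (twistU n).mulVec ((twistU n).mulVec (Rc (((T * S)⁻¹) ^ 2 • y))) = 0 := hRc3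
  obtain ⟨hcu2, hcu3⟩ := span_cobVec_relations hn hcu
  obtain ⟨hcū2, hcū3⟩ := span_cobVec_relations hn hcū
  have hu'2 : ∀ y, u' y + (twistS n).mulVec (u' (S⁻¹ • y)) = 0 := by
    intro y
    rw [hu'eq, hu'eq, Matrix.mulVec_sub]
    calc R y - cu y + ((twistS n).mulVec (R (S⁻¹ • y)) - (twistS n).mulVec (cu (S⁻¹ • y)))
        = (R y + (twistS n).mulVec (R (S⁻¹ • y))) - (cu y + (twistS n).mulVec (cu (S⁻¹ • y))) := by abel
      _ = 0 := by rw [hR2' y, hcu2 y, sub_zero]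
  have hu'3 : ∀ y, u' y + (twistU n).mulVec (u' ((T * S)⁻¹ • y)) +
      (twistU n).mulVec ((twistU n).mulVec (u' (((T * S)⁻¹) ^ 2 • y))) = 0 := by
    intro y
    rw [hu'eq, hu'eq, hu'eq, Matrix.mulVec_sub, Matrix.mulVec_sub, Matrix.mulVec_sub]
    calc R y - cu y + ((twistU n).mulVec (R ((T * S)⁻¹ • y)) - (twistU n).mulVec (cu ((T * S)⁻¹ • y))) +
          ((twistU n).mulVec ((twistU n).mulVec (R (((T * S)⁻¹) ^ 2 • y))) -
            (twistU n).mulVec ((twistU n).mulVec (cu (((T * S)⁻¹) ^ 2 • y))))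
        = (R y + (twistU n).mulVec (R ((T * S)⁻¹ • y)) +
            (twistU n).mulVec ((twistU n).mulVec (R (((T * S)⁻¹) ^ 2 • y)))) -
          (cu y + (twistU n).mulVec (cu ((T * S)⁻¹ • y)) +
            (twistU n).mulVec ((twistU n).mulVec (cu (((T * S)⁻¹) ^ 2 • y)))) := by abel
      _ = 0 := by rw [hR3' y, hcu3 y, sub_zero]
  -- the form
  change (∃ a b c : ℂ, a ∈ K ∧ b ∈ K ∧ c ∈ K ∧ (∑ x, invForm n ((twistP n).mulVec (R (T⁻¹ • x)) -
    (twistPinv n).mulVec (R (T • x))) (Rc x)) = a * Ωp ^ 2 + b * Ωm ^ 2 + c * (Ωp * Ωm * I))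
  have hB1 := haberlandForm_add_left u' cu Rc
  rw [← hRu] at hB1
  have hB2 : ∑ x, invForm n ((twistP n).mulVec (cu (T⁻¹ • x)) - (twistPinv n).mulVec (cu (T • x))) (Rc x) = 0 :=
    span_cobVec_pairing_left hn Rc hRc2' hRc3' hcu
  have hB3 := haberlandForm_add_right u' ū' cū
  rw [← hRcū] at hB3
  have hB4 := haberlandForm_antisymm hn u' cū
  have hB5 : ∑ x, invForm n ((twistP n).mulVec (cū (T⁻¹ • x)) - (twistPinv n).mulVec (cū (T • x))) (u' x) = 0 :=
    span_cobVec_pairing_left hn u' hu'2 hu'3 hcū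
  have hBmain : ∑ x, invForm n ((twistP n).mulVec (R (T⁻¹ • x)) - (twistPinv n).mulVec (R (T • x))) (Rc x) =
      ∑ x, invForm n ((twistP n).mulVec (u' (T⁻¹ • x)) - (twistPinv n).mulVec (u' (T • x))) (ū' x) := by
    rw [hB1, hB2, add_zero, hB3, hB4, hB5, neg_zero, add_zero]
  rw [hBmain, hū'conj]
  refine quad_sum _ fun x _ ↦ ?_
  refine plane_invForm hK (fun j ↦ ?_) (hu'plane x)
  rw [Pi.sub_apply]
  exact plane_sub (plane_twistP (hu'plane (T⁻¹ • x)) j) (plane_twistPinv (hu'plane (T • x)) j)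

end Main


end HaberlandRationality

end Literature.NumberTheory.EllipticCurves.ModularForms
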